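import Mathlib
import Literature.NumberTheory.LFunctions.Zhang2022.ToolkitDivisorMajorants
import Literature.NumberTheory.LFunctions.Zhang2022.ToolkitSmoothEulerMajorant
import Literature.NumberTheory.LFunctions.Zhang2022.Section17MeanSquareMajorant
import Literature.NumberTheory.LFunctions.Zhang2022.AppendixAKappa2PrimePowers
import HarnessLib

/-!
# Zhang (2022) §16/§17 toolkit: `κ₂`-weighted divisor sums are BOUNDED, and their `(m,𝔮) > 1` part is
# `O(|b₁|·log D⁴·τ₂(l₁))` — the sizes behind "drop the terms with `(m₁,𝔮) > 1`" (§17.u021)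

Topic `Literature/NumberTheory/LFunctions/Zhang2022` (Landau–Siegel audit tree; verdict-neutral).
Y. Zhang, *Discrete mean estimates and the Landau–Siegel zero*, arXiv:2211.02515v1 (2022)
[Zhang2022LandauSiegel] — **an unrefereed manuscript under adjudication**; nothing here asserts or denies
its Theorems 1–2. Elementary estimates for Zhang's `κ₂ = n^{−β₁} ∗ μ` (`Σκ₂(n)n^{−s} = ζ(s+β₁)/ζ(s)`,
§16 p. 89; `MeanSquareMajorant.kappa₂ b`, `β₁ = ib`), used by the §17.u021 remainder estimates
(χ-reading RT16-int-1; consumer `Section17U021ChiR2`):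

* `norm_kappa₂_eq_prod_primeFactors`: `|κ₂(n)| = ∏_{q∣n}|κ₂(q)|` — the size at a prime power does NOT
  depend on the exponent (`AppendixA.norm_kappa₂_prime_pow_succ`: `|κ₂(q^{c+1})| = |q^{−ib} − 1| ≤ |b| log q`);
* `sum_fq_div_le`: for the one-prime-removed majorant `f_q(n) = τ₂(n)∏_{p∣n,p≠q}|κ₂(p)|`,
  `Σ_{n≤X} f_q(n)/n ≤ exp(1 + 2|b|(log X + log 4) + S₂)` (Hall–Tenenbaum with the prime sum free,
  `MeanSquareMajorant.sum_div_le_exp_sum`, + Mertens `MertensBound.sum_log_div_prime_le`) — BOUNDED when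
  `|b| log X = O(1)` (Zhang: `α log P = π`);
* `sum_notCoprime_tau_kappa_le`: `Σ_{m≤X, (m,𝔮)>1} τ₂(l₁m)|κ₂(m)|/m ≤ τ₂(l₁)·2|b|(log D⁴ + log 4)·exp(…)`
  (a non-coprime `m` has a prime factor `q < D⁴`, `SmoothEulerMajorant.prime_dvd_frakq_iff`; each `q`
  contributes `2|κ₂(q)|/q·Σf_q/m′`; Mertens over `q < D⁴`).

Theorems only (no definitions, no named facts); axioms standard. WHAT THIS IS NOT: any claim about
Theorems 1–2 of the source or about Landau–Siegel zeros; nothing here bears on the cell's verdict on (8.24).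

## References

* Y. Zhang, arXiv:2211.02515v1 (2022), §16 p. 89 (`κ₂`), §17 p. 98 (u021). [cite: Zhang2022LandauSiegel, §17 u021 p.98]
* R. R. Hall, G. Tenenbaum, *Divisors*, CUP 1988, (0.4). [cite: HallTenenbaum1988, (0.4)]
-/

noncomputable section

open Complex Real Finset ArithmeticFunction
open Literature.NumberTheory.LFunctions.Zhang2022.Skeleton
open Literature.NumberTheory.LFunctions.Zhang2022.MeanSquareMajorant

namespace Literature.NumberTheory.LFunctions.Zhang2022.Phi3Eval

/-! ## §1. `|κ₂(n)|` depends on the radical only (`|κ₂(q^c)| = |κ₂(q)|`, `AppendixAKappa2PrimePowers`) -/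

/-- `|κ₂(n)| = ∏_{q ∣ n} |κ₂(q)|` for `n ≥ 1` (the norm depends on the radical only).
[cite: Zhang2022LandauSiegel, §16 p.89] -/
theorem norm_kappa₂_eq_prod_primeFactors (b : ℝ) {n : ℕ} (hn : n ≠ 0) :
    ‖kappa₂ b n‖ = ∏ p ∈ n.primeFactors, ‖kappa₂ b p‖ := by
  rw [(isMultiplicative_kappa₂ b).multiplicative_factorization _ hn, Finsupp.prod,
    Nat.support_factorization, norm_prod]
  refine Finset.prod_congr rfl fun p hp => ?_
  have hp' : p.Prime := Nat.prime_of_mem_primeFactors hp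
  have hk : n.factorization p ≠ 0 := by
    rw [← Finsupp.mem_support_iff, Nat.support_factorization]; exact hp
  obtain ⟨c, hc⟩ := Nat.exists_eq_succ_of_ne_zero hk
  rw [hc, AppendixA.norm_kappa₂_prime_pow_succ b hp' c, kappa₂_apply_prime b hp']

/-! ## §2. The majorant with one prime removed; bounded `κ₂`-weighted sums -/

/-- **Hall–Tenenbaum with the prime sum free, for `f_q(n) = τ₂(n)·∏_{p∣n, p≠q}|κ₂(p)|`**:
`Σ_{n≤X} f_q(n)/n ≤ exp(1 + 2|b|log 4X + S₂)` (`f_q` multiplicative, `f_q(p^c) ≤ (c+1)²`,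
`f_q(p) ≤ 2|b|log p` for `p ≠ q`, `f_q(q) = 2`; Mertens `Σ_{p≤X} log p/p ≤ log 4X`).
[cite: HallTenenbaum1988, (0.4)] -/
theorem sum_fq_div_le (b : ℝ) {q : ℕ} (hq : q.Prime) (X : ℕ) :
    ∑ n ∈ Icc 1 X, (tau 2 n * ∏ p ∈ n.primeFactors.erase q, ‖kappa₂ b p‖) / n ≤
      Real.exp (1 + 2 * |b| * (Real.log X + Real.log 4) + LogEulerProduct.tailConst 2) := by
  set f : ℕ → ℝ := fun n => tau 2 n * ∏ p ∈ n.primeFactors.erase q, ‖kappa₂ b p‖ with hf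
  have hf1 : f 1 = 1 := by simp [hf, tau_apply_one]
  have hmul : ∀ m n : ℕ, Nat.Coprime m n → f (m * n) = f m * f n := by
    intro m n hmn
    rcases Nat.eq_zero_or_pos m with rfl | hm
    · simp [hf]
    rcases Nat.eq_zero_or_pos n with rfl | hn
    · simp [hf]
    simp only [hf]
    rw [(isMultiplicative_tau 2).map_mul_of_coprime hmn, Nat.primeFactors_mul hm.ne' hn.ne',
      Finset.erase_union_distrib,
      Finset.prod_union ((hmn.disjoint_primeFactors.mono (Finset.erase_subset _ _)
        (Finset.erase_subset _ _)))]
    ring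
  have hf0 : ∀ n, 0 ≤ f n := fun n =>
    mul_nonneg (tau_nonneg _ _) (Finset.prod_nonneg fun p _ => norm_nonneg _)
  have hfpow : ∀ p c : ℕ, p.Prime → f (p ^ c) ≤ ((c : ℝ) + 1) ^ 2 := by
    intro p c hp
    rcases Nat.eq_zero_or_pos c with rfl | hc
    · simp [hf1]
    simp only [hf]
    rw [Nat.primeFactors_prime_pow hc.ne' hp]
    have htau : tau 2 (p ^ c) = (c : ℝ) + 1 := by
      rw [tau_two_apply, Nat.divisors_prime_pow hp, Finset.card_map, Finset.card_range]; push_cast; ring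
    have hprod : ∏ r ∈ ({p} : Finset ℕ).erase q, ‖kappa₂ b r‖ ≤ 2 := by
      by_cases hpq : p = q
      · subst hpq; simp
      · rw [Finset.erase_eq_of_notMem (by simpa using fun h => hpq h.symm), Finset.prod_singleton]
        exact norm_kappa₂_prime_le_two b hp
    rw [htau]
    have h1 : (2 : ℝ) ≤ (c : ℝ) + 1 := by
      have : (1 : ℝ) ≤ c := by exact_mod_cast hc
      linarith
    calc ((c : ℝ) + 1) * ∏ r ∈ ({p} : Finset ℕ).erase q, ‖kappa₂ b r‖ ≤ ((c : ℝ) + 1) * 2 :=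
          mul_le_mul_of_nonneg_left hprod (by positivity)
      _ ≤ ((c : ℝ) + 1) ^ 2 := by rw [sq]; exact mul_le_mul_of_nonneg_left h1 (by positivity)
  have hmain := sum_div_le_exp_sum hf1 hmul hf0 (d := 2) hfpow X
  refine hmain.trans (Real.exp_le_exp.2 ?_)
  -- the prime sum
  have hterm : ∀ p ∈ Nat.primesLE X, f p / p ≤
      (if p = q then (1 : ℝ) else 0) + 2 * |b| * (Real.log p / p) := by
    intro p hp
    have hp' := (Nat.mem_primesLE.1 hp).2
    have hp0 : (0 : ℝ) < p := by exact_mod_cast hp'.pos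
    have hp2 : (2 : ℝ) ≤ p := by exact_mod_cast hp'.two_le
    simp only [hf]
    rw [tau_prime 2 hp', Nat.Prime.primeFactors hp']
    by_cases hpq : p = q
    · subst hpq
      rw [Finset.erase_singleton, Finset.prod_empty, if_pos rfl]
      push_cast
      have hlog : 0 ≤ Real.log p / p := div_nonneg (Real.log_nonneg (by linarith)) hp0.le
      have h2p : (2 : ℝ) * 1 / p ≤ 1 := by rw [div_le_one hp0]; linarith
      nlinarith [abs_nonneg b]
    · rw [Finset.erase_eq_of_notMem (by simpa using fun h => hpq h.symm), Finset.prod_singleton, if_neg hpq,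
        zero_add]
      push_cast
      have h := norm_kappa₂_prime_le b hp'
      calc 2 * ‖kappa₂ b p‖ / p ≤ 2 * (|b| * Real.log p) / p :=
            div_le_div_of_nonneg_right (by nlinarith [norm_nonneg (kappa₂ b p)]) hp0.le
        _ = 2 * |b| * (Real.log p / p) := by ring
  have hsum1 : ∑ p ∈ Nat.primesLE X, (if p = q then (1 : ℝ) else 0) ≤ 1 := by
    rw [Finset.sum_ite_eq']
    split_ifs <;> norm_num
  have hsum2 := MertensBound.sum_log_div_prime_le X
  calc ∑ p ∈ Nat.primesLE X, f p / p + LogEulerProduct.tailConst 2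
      ≤ ∑ p ∈ Nat.primesLE X, ((if p = q then (1 : ℝ) else 0) + 2 * |b| * (Real.log p / p)) +
          LogEulerProduct.tailConst 2 := by
        gcongr with p hp; exact hterm p hp
    _ = (∑ p ∈ Nat.primesLE X, (if p = q then (1 : ℝ) else 0)) +
          2 * |b| * (∑ p ∈ Nat.primesLE X, Real.log p / p) + LogEulerProduct.tailConst 2 := by
        rw [Finset.sum_add_distrib, Finset.mul_sum]
    _ ≤ 1 + 2 * |b| * (Real.log X + Real.log 4) + LogEulerProduct.tailConst 2 := by
        gcongr

/-- For `q ∣ m` (`m ≥ 1`, `q` prime): `τ₂(m)|κ₂(m)| = |κ₂(q)|·f_q(m)` and `f_q(qm′) ≤ 2f_q(m′)`, so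
`τ₂(qm′)|κ₂(qm′)| ≤ 2|κ₂(q)|·f_q(m′)`. [cite: Zhang2022LandauSiegel, §17 u021 p.98] -/
theorem tau_mul_norm_kappa₂_mul_le (b : ℝ) {q : ℕ} (hq : q.Prime) {m : ℕ} (hm : m ≠ 0) :
    tau 2 (q * m) * ‖kappa₂ b (q * m)‖ ≤
      2 * ‖kappa₂ b q‖ * (tau 2 m * ∏ p ∈ m.primeFactors.erase q, ‖kappa₂ b p‖) := by
  have hq0 : q ≠ 0 := hq.ne_zero
  have hqm : q * m ≠ 0 := mul_ne_zero hq0 hm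
  -- `|κ₂(qm)| = |κ₂(q)| · ∏_{p ∣ m, p ≠ q} |κ₂(p)|`
  have hrad : ‖kappa₂ b (q * m)‖ = ‖kappa₂ b q‖ * ∏ p ∈ m.primeFactors.erase q, ‖kappa₂ b p‖ := by
    rw [norm_kappa₂_eq_prod_primeFactors b hqm, Nat.primeFactors_mul hq0 hm, Nat.Prime.primeFactors hq]
    have e : ({q} ∪ m.primeFactors : Finset ℕ) = insert q (m.primeFactors.erase q) := by
      ext p
      simp only [Finset.mem_union, Finset.mem_singleton, Finset.mem_insert, Finset.mem_erase]
      tauto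
    rw [e, Finset.prod_insert (Finset.notMem_erase q _)]
  have htau : tau 2 (q * m) ≤ 2 * tau 2 m := by
    have h := tau_mul_le 2 q m
    rw [tau_prime 2 hq] at h
    exact_mod_cast h
  rw [hrad]
  have h0 : 0 ≤ ‖kappa₂ b q‖ * ∏ p ∈ m.primeFactors.erase q, ‖kappa₂ b p‖ :=
    mul_nonneg (norm_nonneg _) (Finset.prod_nonneg fun _ _ => norm_nonneg _)
  calc tau 2 (q * m) * (‖kappa₂ b q‖ * ∏ p ∈ m.primeFactors.erase q, ‖kappa₂ b p‖)
      ≤ (2 * tau 2 m) * (‖kappa₂ b q‖ * ∏ p ∈ m.primeFactors.erase q, ‖kappa₂ b p‖) :=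
        mul_le_mul_of_nonneg_right htau h0
    _ = 2 * ‖kappa₂ b q‖ * (tau 2 m * ∏ p ∈ m.primeFactors.erase q, ‖kappa₂ b p‖) := by ring

/-- The multiples of `q` in `[1, X]`: `Σ_{m≤X, q∣m} g(m) ≤ Σ_{m′≤X} g(qm′)` for `g ≥ 0` (`m = qm′`).
[folklore] -/
private theorem sum_filter_dvd_le {q : ℕ} (hq : 0 < q) (X : ℕ) {g : ℕ → ℝ} (hg : ∀ m, 0 ≤ g m) :
    ∑ m ∈ (Icc 1 X).filter (fun m => q ∣ m), g m ≤ ∑ m' ∈ Icc 1 X, g (q * m') := by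
  have hsub : (Icc 1 X).filter (fun m => q ∣ m) ⊆ (Icc 1 X).image (fun m' => q * m') := by
    intro m hm
    rw [Finset.mem_filter, Finset.mem_Icc] at hm
    obtain ⟨⟨h1, hX⟩, ⟨m', rfl⟩⟩ := hm
    refine Finset.mem_image.2 ⟨m', Finset.mem_Icc.2 ⟨?_, ?_⟩, rfl⟩
    · rcases Nat.eq_zero_or_pos m' with rfl | h
      · simp at h1
      · exact h
    · exact le_trans (Nat.le_mul_of_pos_left m' hq) hX
  calc ∑ m ∈ (Icc 1 X).filter (fun m => q ∣ m), g m
      ≤ ∑ m ∈ (Icc 1 X).image (fun m' => q * m'), g m :=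
        Finset.sum_le_sum_of_subset_of_nonneg hsub fun m _ _ => hg m
    _ = ∑ m' ∈ Icc 1 X, g (q * m') := by
        rw [Finset.sum_image]
        intro a _ b _ hab
        exact Nat.eq_of_mul_eq_mul_left hq hab

/-- **The `(m,𝔮) > 1` part of the `κ₂`-weighted divisor sum is `O(|b|·𝓛·τ₂(l₁))`**: for `D⁴ ≥ 2` hmm, any
`X ≥ 2`: `Σ_{m≤X, (m,𝔮)>1} τ₂(l₁m)|κ₂(m)|/m ≤ τ₂(l₁)·2|b|(log D⁴ + log 4)·exp(1 + 2|b|(log X + log 4) + S₂)`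
(a non-coprime `m` has a prime factor `q < D⁴`; each such `q` contributes `2|κ₂(q)|/q·Σ f_q/m′`).
[cite: Zhang2022LandauSiegel, §17 u021 p.98] -/
theorem sum_notCoprime_tau_kappa_le (b : ℝ) (D X l₁ : ℕ) :
    ∑ m ∈ (Icc 1 X).filter (fun m => ¬ Nat.Coprime m (frakq D)), tau 2 (l₁ * m) * ‖kappa₂ b m‖ / m ≤
      tau 2 l₁ * (2 * |b| * (Real.log ((D ^ 4 : ℕ) : ℝ) + Real.log 4)) *
        Real.exp (1 + 2 * |b| * (Real.log X + Real.log 4) + LogEulerProduct.tailConst 2) := by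
  set B : ℝ := Real.exp (1 + 2 * |b| * (Real.log X + Real.log 4) + LogEulerProduct.tailConst 2) with hB
  set Q : Finset ℕ := (Finset.range (D ^ 4)).filter Nat.Prime with hQ
  have hB0 : 0 < B := Real.exp_pos _
  have hτ0 : 0 ≤ tau 2 l₁ := tau_nonneg _ _
  -- termwise nonnegativity
  have hg0 : ∀ m : ℕ, 0 ≤ tau 2 (l₁ * m) * ‖kappa₂ b m‖ / m := fun m => by positivity [tau_nonneg 2 (l₁*m)]
  -- every non-coprime `m ≥ 1` has a prime factor `q ∈ Q`
  have hcover : ∀ m ∈ (Icc 1 X).filter (fun m => ¬ Nat.Coprime m (frakq D)),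
      1 ≤ ∑ q ∈ Q, (if q ∣ m then (1 : ℝ) else 0) := by
    intro m hm
    rw [Finset.mem_filter] at hm
    obtain ⟨-, hnc⟩ := hm
    rw [Nat.Prime.not_coprime_iff_dvd] at hnc
    obtain ⟨q, hq, hqm, hqD⟩ := hnc
    have hqQ : q ∈ Q := by
      rw [hQ, Finset.mem_filter, Finset.mem_range]
      exact ⟨(SmoothEulerMajorant.prime_dvd_frakq_iff hq).1 hqD, hq⟩
    have hnn : ∀ r ∈ Q, (0 : ℝ) ≤ (fun r : ℕ => if r ∣ m then (1 : ℝ) else 0) r := fun r _ => by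
      simp only; split_ifs <;> norm_num
    have h1 := Finset.single_le_sum hnn hqQ
    simp only [if_pos hqm] at h1
    exact h1
  -- union bound
  have hstep1 : ∑ m ∈ (Icc 1 X).filter (fun m => ¬ Nat.Coprime m (frakq D)),
      tau 2 (l₁ * m) * ‖kappa₂ b m‖ / m ≤
      ∑ q ∈ Q, ∑ m ∈ (Icc 1 X).filter (fun m => q ∣ m), tau 2 (l₁ * m) * ‖kappa₂ b m‖ / m := by
    calc ∑ m ∈ (Icc 1 X).filter (fun m => ¬ Nat.Coprime m (frakq D)), tau 2 (l₁ * m) * ‖kappa₂ b m‖ / m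
        ≤ ∑ m ∈ (Icc 1 X).filter (fun m => ¬ Nat.Coprime m (frakq D)),
            tau 2 (l₁ * m) * ‖kappa₂ b m‖ / m * ∑ q ∈ Q, (if q ∣ m then (1 : ℝ) else 0) :=
          Finset.sum_le_sum fun m hm => le_mul_of_one_le_right (hg0 m) (hcover m hm)
      _ ≤ ∑ m ∈ Icc 1 X, tau 2 (l₁ * m) * ‖kappa₂ b m‖ / m * ∑ q ∈ Q, (if q ∣ m then (1 : ℝ) else 0) :=
          Finset.sum_le_sum_of_subset_of_nonneg (Finset.filter_subset _ _) fun m _ _ =>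
            mul_nonneg (hg0 m) (Finset.sum_nonneg fun _ _ => by positivity)
      _ = ∑ q ∈ Q, ∑ m ∈ Icc 1 X, (if q ∣ m then tau 2 (l₁ * m) * ‖kappa₂ b m‖ / m else 0) := by
          rw [Finset.sum_comm]
          refine Finset.sum_congr rfl fun m _ => ?_
          rw [Finset.mul_sum]
          refine Finset.sum_congr rfl fun q _ => ?_
          split_ifs <;> simp
      _ = ∑ q ∈ Q, ∑ m ∈ (Icc 1 X).filter (fun m => q ∣ m), tau 2 (l₁ * m) * ‖kappa₂ b m‖ / m := by
          refine Finset.sum_congr rfl fun q _ => ?_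
          rw [Finset.sum_filter]
  -- each `q`
  have hstep2 : ∀ q ∈ Q, ∑ m ∈ (Icc 1 X).filter (fun m => q ∣ m), tau 2 (l₁ * m) * ‖kappa₂ b m‖ / m ≤
      tau 2 l₁ * (2 * |b| * (Real.log q / q)) * B := by
    intro q hqQ
    have hq : q.Prime := (Finset.mem_filter.1 hqQ).2
    have hq0 : (0 : ℝ) < q := by exact_mod_cast hq.pos
    calc ∑ m ∈ (Icc 1 X).filter (fun m => q ∣ m), tau 2 (l₁ * m) * ‖kappa₂ b m‖ / m
        ≤ ∑ m' ∈ Icc 1 X, tau 2 (l₁ * (q * m')) * ‖kappa₂ b (q * m')‖ / ((q * m' : ℕ) : ℝ) :=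
          sum_filter_dvd_le hq.pos X hg0
      _ ≤ ∑ m' ∈ Icc 1 X, tau 2 l₁ * (2 * ‖kappa₂ b q‖ / q) *
            ((tau 2 m' * ∏ p ∈ m'.primeFactors.erase q, ‖kappa₂ b p‖) / m') := by
          refine Finset.sum_le_sum fun m' hm' => ?_
          have hm'0 : m' ≠ 0 := by have := (Finset.mem_Icc.1 hm').1; omega
          have hm'pos : (0 : ℝ) < m' := by exact_mod_cast Nat.pos_of_ne_zero hm'0
          have h1 : tau 2 (l₁ * (q * m')) ≤ tau 2 l₁ * tau 2 (q * m') := tau_mul_le 2 l₁ (q * m')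
          have h2 := tau_mul_norm_kappa₂_mul_le b hq hm'0
          have hτq : 0 ≤ tau 2 (q * m') := tau_nonneg _ _
          rw [Nat.cast_mul, div_le_iff₀ (by positivity)]
          calc tau 2 (l₁ * (q * m')) * ‖kappa₂ b (q * m')‖
              ≤ (tau 2 l₁ * tau 2 (q * m')) * ‖kappa₂ b (q * m')‖ :=
                mul_le_mul_of_nonneg_right h1 (norm_nonneg _)
            _ = tau 2 l₁ * (tau 2 (q * m') * ‖kappa₂ b (q * m')‖) := by ring
            _ ≤ tau 2 l₁ * (2 * ‖kappa₂ b q‖ * (tau 2 m' * ∏ p ∈ m'.primeFactors.erase q, ‖kappa₂ b p‖)) :=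
                mul_le_mul_of_nonneg_left h2 hτ0
            _ = tau 2 l₁ * (2 * ‖kappa₂ b q‖ / q) *
                ((tau 2 m' * ∏ p ∈ m'.primeFactors.erase q, ‖kappa₂ b p‖) / m') * ((q : ℝ) * m') := by
                field_simp
      _ = tau 2 l₁ * (2 * ‖kappa₂ b q‖ / q) *
            ∑ m' ∈ Icc 1 X, (tau 2 m' * ∏ p ∈ m'.primeFactors.erase q, ‖kappa₂ b p‖) / m' := by
          rw [Finset.mul_sum]
      _ ≤ tau 2 l₁ * (2 * ‖kappa₂ b q‖ / q) * B :=
          mul_le_mul_of_nonneg_left (sum_fq_div_le b hq X) (by positivity)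
      _ ≤ tau 2 l₁ * (2 * (|b| * Real.log q) / q) * B := by
          gcongr; exact norm_kappa₂_prime_le b hq
      _ = tau 2 l₁ * (2 * |b| * (Real.log q / q)) * B := by ring
  -- sum over `q < D⁴` by Mertens
  have hQsub : Q ⊆ Nat.primesLE (D ^ 4) := by
    intro q hq
    rw [hQ, Finset.mem_filter, Finset.mem_range] at hq
    exact Nat.mem_primesLE.2 ⟨hq.1.le, hq.2⟩
  have hmert : ∑ q ∈ Q, Real.log q / q ≤ Real.log ((D ^ 4 : ℕ) : ℝ) + Real.log 4 :=
    le_trans (Finset.sum_le_sum_of_subset_of_nonneg hQsub fun q hq _ => by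
      have hq' := (Nat.mem_primesLE.1 hq).2
      exact div_nonneg (Real.log_nonneg (by exact_mod_cast hq'.one_lt.le)) (Nat.cast_nonneg q))
      (MertensBound.sum_log_div_prime_le (D ^ 4))
  calc ∑ m ∈ (Icc 1 X).filter (fun m => ¬ Nat.Coprime m (frakq D)), tau 2 (l₁ * m) * ‖kappa₂ b m‖ / m
      ≤ ∑ q ∈ Q, tau 2 l₁ * (2 * |b| * (Real.log q / q)) * B := hstep1.trans (Finset.sum_le_sum hstep2)
    _ = tau 2 l₁ * (2 * |b| * ∑ q ∈ Q, Real.log q / q) * B := by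
        rw [Finset.mul_sum, Finset.mul_sum, Finset.sum_mul]
    _ ≤ tau 2 l₁ * (2 * |b| * (Real.log ((D ^ 4 : ℕ) : ℝ) + Real.log 4)) * B := by
        gcongr

end Literature.NumberTheory.LFunctions.Zhang2022.Phi3Eval
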